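import Literature.NumberTheory.Sieve.PolymathGEHRoughSlices
import Literature.NumberTheory.Sieve.PolymathGEHTupleGrid
import Literature.NumberTheory.Sieve.PolymathGEHInnerSum
import Literature.NumberTheory.Sieve.FordMaynardPrimeSumsTuples
import HarnessLib

/-!
# Rough square-free integers as prime tuples (§4.5, pp. 17–18, arithmetic bookkeeping)

Trunk AntSieve, tooling toward the named fact `Literature.NumberTheory.Sieve.weakDHL_three_two_of_GEH`
(D. H. J. Polymath, Res. Math. Sci. 1:12 (2014) = arXiv:1407.4897, Theorem 3.2(xii)).

§4.5, pp. 17–18: "if `n` lies in [the window] with all prime factors `> x^ε` then `n = p_1 ⋯ p_r` …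
`λ_{F_k}(n) = (-1)^r ∂_{(log_x p_1)} ⋯ ∂_{(log_x p_r)} F_k(0)`" and the resulting sum is a sum over
prime tuples.  This file does the combinatorial part of that conversion for the diagonal truncated
sum `Σ_{X₁ < m ≤ X₂} λ_F(m)² 1_{p(m) > z}`:

* `lambda_sq_eq_sqIter` — for an injective tuple of primes `q`, `λ_F(∏ qᵢ)² = sqIter F (log qᵢ/log x)ᵢ`;
* `card_filter_injective_image_eq` — a square-free `m` with `r` prime factors is the product of exactly
  `r!` injective prime tuples;
* `roughSqfreeSum_eq` — `r! · Σ_{m square-free rough in window, ω(m) = r} λ_F(m)² =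
  Σ_{q ∈ primes(≤ X₂)^r injective, qᵢ > z, X₁ < ∏q ≤ X₂} sqIter F (log q/log x)`;
* `tupleCount_le` — `#{k-tuples of positive integers with product ≤ y} ≤ y (1 + log y)^k`, used to
  show that non-injective tuples and non-square-free rough integers are negligible.

## References

* [Polymath8b2014] D. H. J. Polymath, Res. Math. Sci. 1 (2014), Art. 12 = arXiv:1407.4897,
  §4.5, pp. 17–18.
-/

noncomputable section

open Finset Real
open scoped BigOperators ArithmeticFunction.omega

namespace Literature.NumberTheory.Sieve

open Depol
open scoped Classical

namespace RoughTuples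

/-! ### The logarithmic coordinates and `λ_F(∏ q)²` -/

/-- `uᵢ = log qᵢ / log x`. [cite: Polymath8b2014, §4.5, p. 18] -/
def logVecX (x : ℝ) {r : ℕ} (q : Fin r → ℕ) : Fin r → ℝ := fun i => Real.log (q i) / Real.log x

/-- The set form of the alternating sum: `Σ_{S ⊆ P} (-1)^{|S|} F((Σ_{p∈S} log p)/log x)`. [cite: Polymath8b2014, §4.5, p. 17] -/
def setAlt (F : ℝ → ℝ) (x : ℝ) (P : Finset ℕ) : ℝ :=
  ∑ S ∈ P.powerset, (-1 : ℝ) ^ #S * F ((∑ p ∈ S, Real.log p) / Real.log x)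

/-- For an injective tuple, the set form over its image is `altSum` of its logarithmic coordinates. [folklore] -/
theorem setAlt_image_eq_altSum (F : ℝ → ℝ) (x : ℝ) {r : ℕ} {q : Fin r → ℕ} (hq : Function.Injective q) :
    setAlt F x (Finset.univ.image q) = altSum F r (logVecX x q) 0 := by
  rw [setAlt, altSum, Finset.powerset_image]
  have hinj : Set.InjOn (fun T : Finset (Fin r) => T.image q) ↑(Finset.univ : Finset (Fin r)).powerset :=
    fun T _ T' _ h => Finset.image_injective hq h
  rw [Finset.sum_image hinj, Finset.powerset_univ]
  refine Finset.sum_congr rfl fun S _ => ?_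
  rw [Finset.card_image_of_injective _ hq, Finset.sum_image fun i _ j _ h => hq h, zero_add]
  congr 1
  simp only [logVecX]
  rw [Finset.sum_div]

/-- The prime factors of a product of distinct primes, and its square-freeness. [folklore] -/
theorem primeFactors_prod_eq_image {r : ℕ} {q : Fin r → ℕ} (hq : Function.Injective q) (hp : ∀ i, (q i).Prime) :
    (∏ i, q i).primeFactors = Finset.univ.image q ∧ Squarefree (∏ i, q i) := by
  have hprod : ∏ i, q i = ∏ p ∈ Finset.univ.image q, p := by
    rw [Finset.prod_image fun i _ j _ h => hq h]
  have hprimes : ∀ p ∈ Finset.univ.image q, p.Prime := by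
    intro p hp'; obtain ⟨i, -, rfl⟩ := Finset.mem_image.1 hp'; exact hp i
  rw [hprod]
  refine ⟨Nat.primeFactors_prod hprimes, Finset.squarefree_prod_of_pairwise_isCoprime ?_ fun p hp' => (hprimes p hp').prime.squarefree⟩
  intro p hp' p' hp'' hne
  exact Nat.coprime_iff_isRelPrime.1 ((Nat.coprime_primes (hprimes p hp') (hprimes p' hp'')).2 hne)

/-- **`λ_F(∏ q)² = sqIter F (log q / log x)`** for an injective tuple of primes
("`λ_{F_k}(n) = (-1)^r ∂_{(log_x p_1)}⋯∂_{(log_x p_r)} F_k(0)`", p. 17). [cite: Polymath8b2014, §4.5, p. 17] -/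
theorem lambda_sq_eq_sqIter (F : ℝ → ℝ) (x : ℝ) {r : ℕ} {q : Fin r → ℕ} (hq : Function.Injective q)
    (hp : ∀ i, (q i).Prime) : divisorSumWeight F x (∏ i, q i) ^ 2 = sqIter F (logVecX x q) := by
  obtain ⟨hpf, hsq⟩ := primeFactors_prod_eq_image hq hp
  rw [divisorSumWeight_eq_sum_powerset F x hsq, hpf, sqIter_eq_altSum_sq, ← setAlt_image_eq_altSum F x hq, setAlt]

/-! ### Counting the enumerations of a set of primes -/

/-- The injective tuples with values in `P` (`|P| = r`) are the embeddings `Fin r ↪ P`: there are `r!`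
of them. [folklore] -/
theorem card_filter_injective_eq_factorial {r : ℕ} (P : Finset ℕ) (hP : P.card = r) :
    ((Fintype.piFinset fun _ : Fin r => P).filter fun q => Function.Injective q).card = Nat.factorial r := by
  classical
  set S := (Fintype.piFinset fun _ : Fin r => P).filter fun q => Function.Injective q with hS
  -- equivalence with `Fin r ↪ ↥P`
  have e : {q // q ∈ S} ≃ (Fin r ↪ {p // p ∈ P}) :=
    { toFun := fun q => ⟨fun i => ⟨q.1 i, Fintype.mem_piFinset.1 (Finset.mem_filter.1 q.2).1 i⟩,
        fun i j h => (Finset.mem_filter.1 q.2).2 (by simpa using congrArg Subtype.val h)⟩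
      invFun := fun f => ⟨fun i => (f i).1, Finset.mem_filter.2 ⟨Fintype.mem_piFinset.2 fun i => (f i).2,
        fun i j h => f.injective (Subtype.ext h)⟩⟩
      left_inv := fun q => by ext; rfl
      right_inv := fun f => by ext; rfl }
  rw [← Fintype.card_coe S, Fintype.card_congr e, Fintype.card_embedding_eq, Fintype.card_coe, hP,
    Fintype.card_fin, Nat.descFactorial_self]

/-- For square-free `m` with `r` prime factors, the injective prime tuples with product `m` are exactly
the injective tuples with values in `primeFactors m`. [folklore] -/
theorem prod_eq_iff_of_squarefree {m : ℕ} (hm : Squarefree m) {r : ℕ} (hr : m.primeFactors.card = r)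
    {q : Fin r → ℕ} (hq : Function.Injective q) (hp : ∀ i, (q i).Prime) :
    ∏ i, q i = m ↔ ∀ i, q i ∈ m.primeFactors := by
  obtain ⟨hpf, hsq⟩ := primeFactors_prod_eq_image hq hp
  constructor
  · rintro rfl i
    rw [hpf]; exact Finset.mem_image_of_mem q (Finset.mem_univ i)
  · intro h
    have hsub : Finset.univ.image q ⊆ m.primeFactors := fun p hp' => by
      obtain ⟨i, -, rfl⟩ := Finset.mem_image.1 hp'; exact h i
    have hcard : (Finset.univ.image q).card = r := by
      rw [Finset.card_image_of_injective _ hq, Finset.card_univ, Fintype.card_fin]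
    have heq : Finset.univ.image q = m.primeFactors :=
      Finset.eq_of_subset_of_card_le hsub (by rw [hcard, hr])
    calc ∏ i, q i = ∏ p ∈ (∏ i, q i).primeFactors, p := (Nat.prod_primeFactors_of_squarefree hsq).symm
      _ = ∏ p ∈ m.primeFactors, p := by rw [hpf, heq]
      _ = m := Nat.prod_primeFactors_of_squarefree hm

/-! ### The square-free rough sum as a sum over injective prime tuples -/

/-- The square-free rough integers of the window with `r` prime factors. [cite: Polymath8b2014, §4.5, p. 17] -/
def roughSqfree (X₁ X₂ : ℕ) (z : ℝ) (r : ℕ) : Finset ℕ :=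
  (Finset.Ioc X₁ X₂).filter fun m => Squarefree m ∧ (∀ p ∈ m.primeFactors, z < (p : ℝ)) ∧ m.primeFactors.card = r

/-- The prime tuples charged by the truncated sum: distinct primes `> z` with product in the window. [cite: Polymath8b2014, §4.5, p. 18] -/
def goodTuples (X₁ X₂ : ℕ) (z : ℝ) (r : ℕ) : Finset (Fin r → ℕ) :=
  (Fintype.piFinset fun _ : Fin r => Nat.primesLE X₂).filter fun q =>
    Function.Injective q ∧ (∀ i, z < (q i : ℝ)) ∧ X₁ < ∏ i, q i ∧ ∏ i, q i ≤ X₂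

/-- Membership in `roughSqfree`. [folklore] -/
theorem mem_roughSqfree {X₁ X₂ : ℕ} {z : ℝ} {r : ℕ} {m : ℕ} :
    m ∈ roughSqfree X₁ X₂ z r ↔ (X₁ < m ∧ m ≤ X₂) ∧ Squarefree m ∧ (∀ p ∈ m.primeFactors, z < (p : ℝ)) ∧
      m.primeFactors.card = r := by
  rw [roughSqfree, Finset.mem_filter, Finset.mem_Ioc]

/-- Membership in `goodTuples`. [folklore] -/
theorem mem_goodTuples {X₁ X₂ : ℕ} {z : ℝ} {r : ℕ} {q : Fin r → ℕ} :
    q ∈ goodTuples X₁ X₂ z r ↔ (∀ i, (q i).Prime ∧ q i ≤ X₂) ∧ Function.Injective q ∧ (∀ i, z < (q i : ℝ)) ∧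
      X₁ < ∏ i, q i ∧ ∏ i, q i ≤ X₂ := by
  simp only [goodTuples, Finset.mem_filter, Fintype.mem_piFinset, Nat.mem_primesLE]
  constructor
  · rintro ⟨h1, h2⟩; exact ⟨fun i => ⟨(h1 i).2, (h1 i).1⟩, h2⟩
  · rintro ⟨h1, h2⟩; exact ⟨fun i => ⟨(h1 i).2, (h1 i).1⟩, h2⟩

/-- The product of a good tuple is a square-free rough integer of the window with `r` prime factors. [folklore] -/
theorem prod_mem_roughSqfree {X₁ X₂ : ℕ} {z : ℝ} {r : ℕ} {q : Fin r → ℕ} (hq : q ∈ goodTuples X₁ X₂ z r) :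
    ∏ i, q i ∈ roughSqfree X₁ X₂ z r := by
  obtain ⟨hpr, hinj, hzq, h1, h2⟩ := mem_goodTuples.1 hq
  obtain ⟨hpf, hsq⟩ := primeFactors_prod_eq_image hinj fun i => (hpr i).1
  refine mem_roughSqfree.2 ⟨⟨h1, h2⟩, hsq, fun p hp => ?_, ?_⟩
  · rw [hpf] at hp; obtain ⟨i, -, rfl⟩ := Finset.mem_image.1 hp; exact hzq i
  · rw [hpf, Finset.card_image_of_injective _ hinj, Finset.card_univ, Fintype.card_fin]

/-- **The square-free rough sum as a tuple sum**:
`r! Σ_{m ∈ roughSqfree} g(m) = Σ_{q ∈ goodTuples} g(∏ q)`. [cite: Polymath8b2014, §4.5, pp. 17–18] -/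
theorem factorial_mul_sum_roughSqfree {X₁ X₂ : ℕ} {z : ℝ} (r : ℕ) (g : ℕ → ℝ) :
    (Nat.factorial r : ℝ) * ∑ m ∈ roughSqfree X₁ X₂ z r, g m = ∑ q ∈ goodTuples X₁ X₂ z r, g (∏ i, q i) := by
  classical
  rw [Finset.mul_sum]
  symm
  rw [← Finset.sum_fiberwise_of_maps_to (s := goodTuples X₁ X₂ z r) (t := roughSqfree X₁ X₂ z r)
    (g := fun q => ∏ i, q i) fun q hq => prod_mem_roughSqfree hq]
  refine Finset.sum_congr rfl fun m hm => ?_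
  obtain ⟨⟨hm1, hm2⟩, hsq, hrough, hcard⟩ := mem_roughSqfree.1 hm
  -- the fibre over `m`
  have hfib : (goodTuples X₁ X₂ z r).filter (fun q => ∏ i, q i = m) =
      (Fintype.piFinset fun _ : Fin r => m.primeFactors).filter fun q => Function.Injective q := by
    ext q
    simp only [Finset.mem_filter, mem_goodTuples, Fintype.mem_piFinset]
    constructor
    · rintro ⟨⟨hpr, hinj, -, -, -⟩, hprod⟩
      exact ⟨(prod_eq_iff_of_squarefree hsq hcard hinj fun i => (hpr i).1).1 hprod, hinj⟩
    · rintro ⟨hmem, hinj⟩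
      have hpr : ∀ i, (q i).Prime := fun i => Nat.prime_of_mem_primeFactors (hmem i)
      have hprod : ∏ i, q i = m := (prod_eq_iff_of_squarefree hsq hcard hinj hpr).2 hmem
      refine ⟨⟨fun i => ⟨hpr i, ?_⟩, hinj, fun i => hrough _ (hmem i), hprod ▸ hm1, hprod ▸ hm2⟩, hprod⟩
      exact (Nat.le_of_mem_primeFactors (hmem i)).trans hm2
  rw [Finset.sum_congr rfl (fun q hq => by rw [(Finset.mem_filter.1 hq).2]), Finset.sum_const, hfib,
    card_filter_injective_eq_factorial _ hcard, nsmul_eq_mul]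

/-- **The diagonal truncated sum of order `r` as a tuple sum of `sqIter`**:
`r! Σ_{m ∈ roughSqfree r} λ_F(m)² = Σ_{q ∈ goodTuples r} sqIter F (log q/log x)`. [cite: Polymath8b2014, §4.5, pp. 17–18] -/
theorem factorial_mul_sum_lambda_sq (F : ℝ → ℝ) (x : ℝ) {X₁ X₂ : ℕ} {z : ℝ} (r : ℕ) :
    (Nat.factorial r : ℝ) * ∑ m ∈ roughSqfree X₁ X₂ z r, divisorSumWeight F x m ^ 2 =
      ∑ q ∈ goodTuples X₁ X₂ z r, sqIter F (logVecX x q) := by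
  rw [factorial_mul_sum_roughSqfree r (fun m => divisorSumWeight F x m ^ 2)]
  refine Finset.sum_congr rfl fun q hq => ?_
  obtain ⟨hpr, hinj, -, -, -⟩ := mem_goodTuples.1 hq
  exact lambda_sq_eq_sqIter F x hinj fun i => (hpr i).1

/-! ### The exceptional integers: a large prime factor with multiplicity -/

/-- The integers `≤ X` with a prime factor `p > z` of multiplicity `≥ 2`. [cite: Polymath8b2014, §4.5, p. 17] -/
def sqMultiples (X : ℕ) (z : ℝ) : Finset ℕ :=
  (Finset.Icc 1 X).filter fun m => ∃ p : ℕ, p.Prime ∧ z < (p : ℝ) ∧ p * p ∣ m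

/-- **`#sqMultiples ≤ X / ⌊z⌋`** (`z ≥ 1`): sum `X/p²` over `p > z`. [folklore] -/
theorem card_sqMultiples_le {X : ℕ} {z : ℝ} (hz : 1 ≤ z) : ((sqMultiples X z).card : ℝ) ≤ (X : ℝ) / ⌊z⌋₊ := by
  set k := ⌊z⌋₊ with hk
  have hk1 : 1 ≤ k := Nat.le_floor (by exact_mod_cast hz)
  have hcover : sqMultiples X z ⊆ (Finset.Ioc k X).biUnion fun p => (Finset.Icc 1 X).filter fun m => p * p ∣ m := by
    intro m hm
    rw [sqMultiples, Finset.mem_filter, Finset.mem_Icc] at hm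
    obtain ⟨⟨hm1, hmX⟩, p, hp, hzp, hdvd⟩ := hm
    rw [Finset.mem_biUnion]
    refine ⟨p, Finset.mem_Ioc.2 ⟨(Nat.floor_lt (by linarith)).2 hzp, ?_⟩, Finset.mem_filter.2 ⟨Finset.mem_Icc.2 ⟨hm1, hmX⟩, hdvd⟩⟩
    exact le_trans (Nat.le_of_dvd (by omega) (dvd_trans (Dvd.intro _ rfl) hdvd)) hmX
  calc ((sqMultiples X z).card : ℝ) ≤ ∑ p ∈ Finset.Ioc k X, (((Finset.Icc 1 X).filter fun m => p * p ∣ m).card : ℝ) := by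
        exact_mod_cast (Finset.card_le_card hcover).trans Finset.card_biUnion_le
    _ ≤ ∑ p ∈ Finset.Ioc k X, (X : ℝ) * ((p : ℝ) ^ 2)⁻¹ := by
        refine Finset.sum_le_sum fun p hp => ?_
        have hp0 : 0 < p := by have := (Finset.mem_Ioc.1 hp).1; omega
        rw [show Finset.Icc 1 X = Finset.Ioc 0 X from rfl, Nat.Ioc_filter_dvd_card_eq_div]
        calc ((X / (p * p) : ℕ) : ℝ) ≤ (X : ℝ) / ((p * p : ℕ) : ℝ) := Nat.cast_div_le
          _ = (X : ℝ) * ((p : ℝ) ^ 2)⁻¹ := by push_cast; rw [sq, div_eq_mul_inv]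
    _ = (X : ℝ) * ∑ p ∈ Finset.Ioc k X, ((p : ℝ) ^ 2)⁻¹ := by rw [Finset.mul_sum]
    _ ≤ (X : ℝ) * (k : ℝ)⁻¹ := by
        refine mul_le_mul_of_nonneg_left ?_ (Nat.cast_nonneg _)
        rcases le_or_gt k X with hkX | hkX
        · exact (sum_Ioc_inv_sq_le_sub (by omega) hkX).trans (by
            have : (0 : ℝ) ≤ (X : ℝ)⁻¹ := by positivity
            linarith)
        · rw [Finset.Ioc_eq_empty (by omega), Finset.sum_empty]; positivity
    _ = (X : ℝ) / ⌊z⌋₊ := by rw [hk, div_eq_mul_inv]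

/-! ### Non-injective tuples are few -/

/-- The tuples charged by the truncated tuple sum without the injectivity condition. [cite: Polymath8b2014, §4.5, p. 18] -/
def allTuples (X₁ X₂ : ℕ) (z : ℝ) (r : ℕ) : Finset (Fin r → ℕ) :=
  (Fintype.piFinset fun _ : Fin r => Nat.primesLE X₂).filter fun q =>
    (∀ i, z < (q i : ℝ)) ∧ X₁ < ∏ i, q i ∧ ∏ i, q i ≤ X₂

/-- Good tuples are the injective ones among all tuples. [folklore] -/
theorem goodTuples_eq_filter (X₁ X₂ : ℕ) (z : ℝ) (r : ℕ) :
    goodTuples X₁ X₂ z r = (allTuples X₁ X₂ z r).filter fun q => Function.Injective q := by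
  ext q; simp only [goodTuples, allTuples, Finset.mem_filter]; tauto

/-- The non-injective tuples map into `sqMultiples`, with fibres of size `≤ r^r`; hence there are at
most `r^r · #sqMultiples` of them. [folklore] -/
theorem card_nonInjective_le (X₁ X₂ : ℕ) (z : ℝ) (r : ℕ) :
    (((allTuples X₁ X₂ z r).filter fun q => ¬ Function.Injective q).card : ℝ) ≤ (r : ℝ) ^ r * (sqMultiples X₂ z).card := by
  classical
  set s := (allTuples X₁ X₂ z r).filter fun q => ¬ Function.Injective q with hs
  -- fibres of the product map
  have hfib : ∀ m ∈ s.image (fun q => ∏ i, q i), (s.filter fun q => ∏ i, q i = m).card ≤ r ^ r := by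
    intro m hm
    obtain ⟨q₀, hq₀, rfl⟩ := Finset.mem_image.1 hm
    have hq₀' := (Finset.mem_filter.1 (Finset.mem_filter.1 hq₀).1)
    have hpr : ∀ i, (q₀ i).Prime := fun i => (Nat.mem_primesLE.1 (Fintype.mem_piFinset.1 hq₀'.1 i)).2
    -- every `q` in the fibre takes values in the prime factors of the product
    have hsub : (s.filter fun q => ∏ i, q i = ∏ i, q₀ i) ⊆ Fintype.piFinset fun _ : Fin r => (∏ i, q₀ i).primeFactors := by
      intro q hq
      obtain ⟨hq1, hq2⟩ := Finset.mem_filter.1 hq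
      have hq1' := Finset.mem_filter.1 (Finset.mem_filter.1 hq1).1
      have hprq : ∀ i, (q i).Prime := fun i => (Nat.mem_primesLE.1 (Fintype.mem_piFinset.1 hq1'.1 i)).2
      refine Fintype.mem_piFinset.2 fun i => Nat.mem_primeFactors.2 ⟨hprq i, ?_, ?_⟩
      · rw [← hq2]; exact Finset.dvd_prod_of_mem _ (Finset.mem_univ i)
      · exact Finset.prod_ne_zero_iff.2 fun i _ => (hpr i).ne_zero
    have hcardpf : (∏ i, q₀ i).primeFactors.card ≤ r := by
      have : (∏ i, q₀ i).primeFactors ⊆ Finset.univ.image q₀ := by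
        intro p hp
        obtain ⟨hp1, hp2, -⟩ := Nat.mem_primeFactors.1 hp
        obtain ⟨i, -, hi⟩ := (hp1.prime.dvd_finsetProd_iff _).1 hp2
        exact Finset.mem_image.2 ⟨i, Finset.mem_univ _, ((Nat.prime_dvd_prime_iff_eq hp1 (hpr i)).1 hi).symm⟩
      refine (Finset.card_le_card this).trans (Finset.card_image_le.trans ?_)
      rw [Finset.card_univ, Fintype.card_fin]
    calc (s.filter fun q => ∏ i, q i = ∏ i, q₀ i).card ≤ (Fintype.piFinset fun _ : Fin r => (∏ i, q₀ i).primeFactors).card :=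
          Finset.card_le_card hsub
      _ = (∏ i, q₀ i).primeFactors.card ^ r := by rw [Fintype.card_piFinset, Finset.prod_const, Finset.card_univ, Fintype.card_fin]
      _ ≤ r ^ r := Nat.pow_le_pow_left hcardpf r
  have h1 := Finset.card_le_mul_card_image s (r ^ r) hfib
  -- the image lies in `sqMultiples`
  have himg : s.image (fun q => ∏ i, q i) ⊆ sqMultiples X₂ z := by
    intro m hm
    obtain ⟨q, hq, rfl⟩ := Finset.mem_image.1 hm
    obtain ⟨hq1, hninj⟩ := Finset.mem_filter.1 hq
    obtain ⟨hq1', hzq, -, hX⟩ := Finset.mem_filter.1 hq1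
    have hpr : ∀ i, (q i).Prime := fun i => (Nat.mem_primesLE.1 (Fintype.mem_piFinset.1 hq1' i)).2
    obtain ⟨i, j, hij, hne⟩ : ∃ i j, q i = q j ∧ i ≠ j := by
      by_contra h; push Not at h; exact hninj fun i j hq => h i j hq
    rw [sqMultiples, Finset.mem_filter, Finset.mem_Icc]
    refine ⟨⟨Nat.one_le_iff_ne_zero.2 (Finset.prod_ne_zero_iff.2 fun i _ => (hpr i).ne_zero), hX⟩, q i, hpr i, hzq i, ?_⟩
    have : q i * q j ∣ ∏ k, q k := by
      rw [← Finset.prod_pair hne]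
      exact Finset.prod_dvd_prod_of_subset _ _ _ (Finset.subset_univ _)
    rwa [← hij] at this
  calc (s.card : ℝ) ≤ ((r ^ r * (s.image fun q => ∏ i, q i).card : ℕ) : ℝ) := by exact_mod_cast h1
    _ ≤ (r : ℝ) ^ r * (sqMultiples X₂ z).card := by
        push_cast
        exact mul_le_mul_of_nonneg_left (by exact_mod_cast Finset.card_le_card himg) (by positivity)

/-! ### The decomposition of the diagonal truncated inner sum -/

/-- The number of prime factors (with multiplicity) of a `z`-rough `m ≤ z^R` is `< R`… precisely: if all
prime factors of `m ≠ 0` exceed `z ≥ 1` and `m ≤ Y` then `z^{Ω(m)} ≤ Y`. [folklore] -/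
theorem pow_length_primeFactorsList_le {m : ℕ} (hm : m ≠ 0) {z : ℝ} (hz : 0 ≤ z)
    (hrough : ∀ p ∈ m.primeFactorsList, z < (p : ℝ)) : z ^ m.primeFactorsList.length ≤ (m : ℝ) := by
  have := pow_length_le_prod' hz m.primeFactorsList hrough
  rwa [Nat.prod_primeFactorsList hm] at this
where
  /-- auxiliary: lists of naturals `> z ≥ 0` have product `≥ z^{length}` -/
  pow_length_le_prod' {z : ℝ} (hz : 0 ≤ z) : ∀ (l : List ℕ), (∀ p ∈ l, z < (p : ℝ)) → z ^ l.length ≤ ((l.prod : ℕ) : ℝ)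
  | [], _ => by simp
  | p :: l, h => by
    rw [List.length_cons, pow_succ, List.prod_cons, Nat.cast_mul, mul_comm ((p : ℕ) : ℝ)]
    have hp := h p List.mem_cons_self
    have ih := pow_length_le_prod' hz l (fun q hq => h q (List.mem_cons_of_mem _ hq))
    exact mul_le_mul ih hp.le hz (Nat.cast_nonneg _)

/-- For `x ≥ 4`, `x^ε ≥ 3`, a rough `m ≤ 3x` has at most `⌊1/ε⌋ + 1` prime factors, hence
`ω(m) ≤ ⌊1/ε⌋ + 1` and `|λ_F(m)| ≤ 2^{⌊1/ε⌋+1} M`. [cite: Polymath8b2014, §4.5, p. 17] -/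
theorem card_primeFactors_le_of_rough {x ε : ℝ} (hε : 0 < ε) (hx4 : 4 ≤ x) (hxε : 3 ≤ x ^ ε) {m : ℕ} (hm : m ≠ 0)
    (hm3 : (m : ℝ) ≤ 3 * x) (hrough : ∀ p ∈ m.primeFactorsList, x ^ ε < (p : ℝ)) :
    m.primeFactors.card ≤ ⌊1 / ε⌋₊ + 1 ∧ m.primeFactorsList.length ≤ ⌊1 / ε⌋₊ + 1 := by
  have hx0 : 0 < x := by linarith
  set r := m.primeFactorsList.length with hr
  have hprod : (x ^ ε) ^ r ≤ m := pow_length_primeFactorsList_le hm (Real.rpow_nonneg hx0.le ε) hrough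
  have h1 : (r : ℝ) * (ε * Real.log x) ≤ Real.log 3 + Real.log x := by
    have h2 : Real.log ((x ^ ε) ^ r) ≤ Real.log (3 * x) :=
      Real.log_le_log (by positivity) (hprod.trans hm3)
    rwa [Real.log_pow, Real.log_rpow hx0, Real.log_mul (by norm_num) hx0.ne'] at h2
  have h3 : Real.log 3 ≤ ε * Real.log x := by
    have := Real.log_le_log (by norm_num) hxε
    rwa [Real.log_rpow hx0] at this
  have hlog : 0 < Real.log x := Real.log_pos (by linarith)
  have h4 : (r : ℝ) ≤ 1 / ε + 1 := by
    have hεl : 0 < ε * Real.log x := by positivity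
    have : (r : ℝ) * (ε * Real.log x) ≤ (1 / ε + 1) * (ε * Real.log x) := by
      have e : (1 / ε + 1) * (ε * Real.log x) = Real.log x + ε * Real.log x := by field_simp
      rw [e]; linarith
    exact le_of_mul_le_mul_right this hεl
  have h5 : r ≤ ⌊1 / ε + 1⌋₊ := Nat.le_floor h4
  rw [Nat.floor_add_one (by positivity)] at h5
  refine ⟨?_, h5⟩
  calc m.primeFactors.card = m.primeFactorsList.dedup.length := by rw [Nat.primeFactors, List.card_toFinset]
    _ ≤ r := (List.dedup_sublist _).length_le
    _ ≤ _ := h5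

/-- The rough non-square-free integers of the window. [folklore] -/
def roughNonSqfree (X₁ X₂ : ℕ) (z : ℝ) : Finset ℕ :=
  (Finset.Ioc X₁ X₂).filter fun m => ¬ Squarefree m ∧ ∀ p ∈ m.primeFactors, z < (p : ℝ)

/-- Rough non-square-free numbers have a repeated large prime factor. [folklore] -/
theorem roughNonSqfree_subset_sqMultiples (X₁ X₂ : ℕ) (z : ℝ) : roughNonSqfree X₁ X₂ z ⊆ sqMultiples X₂ z := by
  intro m hm
  rw [roughNonSqfree, Finset.mem_filter, Finset.mem_Ioc] at hm
  obtain ⟨⟨hm1, hm2⟩, hnsq, hrough⟩ := hm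
  have hm0 : m ≠ 0 := by omega
  rw [Nat.squarefree_iff_prime_squarefree] at hnsq
  push Not at hnsq
  obtain ⟨p, hp, hdvd⟩ := hnsq
  rw [sqMultiples, Finset.mem_filter, Finset.mem_Icc]
  refine ⟨⟨by omega, hm2⟩, p, hp, hrough p (Nat.mem_primeFactors.2 ⟨hp, dvd_trans (Dvd.intro _ rfl) hdvd, hm0⟩), hdvd⟩

/-- **Decomposition of the diagonal truncated inner sum** (`x ≥ 4`, `x^ε ≥ 3`, window below `3x`,
`X₁ ≥ 1`): `Σ_{X₁<m≤X₂} λ_F(m)² 1_{p(m)>x^ε} = Σ_{1≤r≤R₀} Σ_{m ∈ roughSqfree r} λ_F(m)² + Σ_{roughNonSqfree} λ_F(m)²`,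
`R₀ = ⌊1/ε⌋ + 1`. [cite: Polymath8b2014, §4.5, p. 17] -/
theorem innerTotal_wTrunc_diag_eq (F : ℝ → ℝ) {x ε : ℝ} (hε : 0 < ε) (hx4 : 4 ≤ x) (hxε : 3 ≤ x ^ ε)
    {X₁ X₂ : ℕ} (hX₁ : 1 ≤ X₁) (hX₂ : (X₂ : ℝ) ≤ 3 * x) :
    innerTotal (wTrunc F F ε x) X₁ X₂ =
      ∑ r ∈ Finset.Icc 1 (⌊1 / ε⌋₊ + 1), ∑ m ∈ roughSqfree X₁ X₂ (x ^ ε) r, divisorSumWeight F x m ^ 2 +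
        ∑ m ∈ roughNonSqfree X₁ X₂ (x ^ ε), divisorSumWeight F x m ^ 2 := by
  classical
  rw [innerTotal]
  -- only rough `m` contribute, and the contribution is `λ_F(m)²`
  have hsplit : ∑ m ∈ Finset.Ioc X₁ X₂, wTrunc F F ε x m =
      ∑ m ∈ (Finset.Ioc X₁ X₂).filter (fun m : ℕ => ∀ p : ℕ, p ∈ m.primeFactors → x ^ ε < (p : ℝ)), divisorSumWeight F x m ^ 2 := by
    rw [Finset.sum_filter]
    refine Finset.sum_congr rfl fun m _ => ?_
    rw [wTrunc, roughInd]
    have hiff : (∀ p : ℕ, p ∈ m.primeFactorsList → x ^ ε < (p : ℝ)) ↔ ∀ p : ℕ, p ∈ m.primeFactors → x ^ ε < (p : ℝ) := by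
      simp only [Nat.mem_primeFactors_iff_mem_primeFactorsList]
    by_cases h : ∀ p : ℕ, p ∈ m.primeFactors → x ^ ε < (p : ℝ)
    · rw [if_pos (hiff.2 h), if_pos h]; ring
    · rw [if_neg (fun h' => h (hiff.1 h')), if_neg h, mul_zero]
  rw [hsplit]
  set R := (Finset.Ioc X₁ X₂).filter (fun m : ℕ => ∀ p : ℕ, p ∈ m.primeFactors → x ^ ε < (p : ℝ)) with hR
  rw [← Finset.sum_filter_add_sum_filter_not R Squarefree]
  congr 1
  · -- square-free part, by number of prime factors
    have hmaps : ∀ m ∈ R.filter Squarefree, m.primeFactors.card ∈ Finset.Icc 1 (⌊1 / ε⌋₊ + 1) := by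
      intro m hm
      obtain ⟨hmR, -⟩ := Finset.mem_filter.1 hm
      obtain ⟨hm, hrough⟩ := Finset.mem_filter.1 hmR
      rw [Finset.mem_Ioc] at hm
      have hm0 : m ≠ 0 := by omega
      have hm3 : (m : ℝ) ≤ 3 * x := le_trans (by exact_mod_cast hm.2) hX₂
      rw [Finset.mem_Icc]
      refine ⟨?_, (card_primeFactors_le_of_rough hε hx4 hxε hm0 hm3 fun p hp =>
        hrough p (Nat.mem_primeFactors_iff_mem_primeFactorsList.2 hp)).1⟩
      obtain ⟨p, hp, hpm⟩ := Nat.exists_prime_and_dvd (show m ≠ 1 by omega)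
      exact Finset.card_pos.2 ⟨p, Nat.mem_primeFactors.2 ⟨hp, hpm, hm0⟩⟩
    rw [← Finset.sum_fiberwise_of_maps_to hmaps]
    refine Finset.sum_congr rfl fun r _ => Finset.sum_congr ?_ fun _ _ => rfl
    ext m
    simp only [Finset.mem_filter, hR, roughSqfree, Finset.mem_Ioc]
    tauto
  · refine Finset.sum_congr ?_ fun _ _ => rfl
    ext m
    simp only [Finset.mem_filter, hR, roughNonSqfree, Finset.mem_Ioc]
    tauto

/-- **The non-square-free rough part is negligible**: for `|F| ≤ M` it is at most
`4^{⌊1/ε⌋+1} M² · X₂/⌊x^ε⌋`. [cite: Polymath8b2014, §4.5, p. 17] -/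
theorem abs_sum_roughNonSqfree_le {F : ℝ → ℝ} {M : ℝ} (hMF : ∀ t, |F t| ≤ M) {x ε : ℝ} (hε : 0 < ε) (hx4 : 4 ≤ x)
    (hxε : 3 ≤ x ^ ε) {X₁ X₂ : ℕ} (hX₂ : (X₂ : ℝ) ≤ 3 * x) :
    |∑ m ∈ roughNonSqfree X₁ X₂ (x ^ ε), divisorSumWeight F x m ^ 2| ≤
      4 ^ (⌊1 / ε⌋₊ + 1) * M ^ 2 * ((X₂ : ℝ) / ⌊x ^ ε⌋₊) := by
  have hM0 : 0 ≤ M := (abs_nonneg _).trans (hMF 0)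
  have hterm : ∀ m ∈ roughNonSqfree X₁ X₂ (x ^ ε), |divisorSumWeight F x m ^ 2| ≤ 4 ^ (⌊1 / ε⌋₊ + 1) * M ^ 2 := by
    intro m hm
    rw [roughNonSqfree, Finset.mem_filter, Finset.mem_Ioc] at hm
    obtain ⟨⟨hm1, hm2⟩, -, hrough⟩ := hm
    have hm0 : m ≠ 0 := by omega
    have hω : ω m ≤ ⌊1 / ε⌋₊ + 1 := by
      have h := (card_primeFactors_le_of_rough hε hx4 hxε hm0 (le_trans (by exact_mod_cast hm2) hX₂) fun p hp =>
        hrough p (Nat.mem_primeFactors_iff_mem_primeFactorsList.2 hp)).1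
      rwa [ArithmeticFunction.cardDistinctFactors_apply, ← List.card_toFinset]
    have hlam := abs_divisorSumWeight_le_two_pow hMF x hm0
    rw [abs_pow]
    calc |divisorSumWeight F x m| ^ 2 ≤ (2 ^ ω m * M) ^ 2 := pow_le_pow_left₀ (abs_nonneg _) hlam 2
      _ ≤ (2 ^ (⌊1 / ε⌋₊ + 1) * M) ^ 2 := by
          refine pow_le_pow_left₀ (by positivity) (mul_le_mul_of_nonneg_right (pow_le_pow_right₀ (by norm_num) hω) hM0) 2
      _ = 4 ^ (⌊1 / ε⌋₊ + 1) * M ^ 2 := by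
          rw [mul_pow, ← pow_mul, mul_comm (⌊1 / ε⌋₊ + 1) 2, pow_mul]; norm_num
  have hz : (1 : ℝ) ≤ x ^ ε := by linarith
  calc |∑ m ∈ roughNonSqfree X₁ X₂ (x ^ ε), divisorSumWeight F x m ^ 2|
      ≤ ∑ m ∈ roughNonSqfree X₁ X₂ (x ^ ε), |divisorSumWeight F x m ^ 2| := Finset.abs_sum_le_sum_abs _ _
    _ ≤ ∑ _m ∈ roughNonSqfree X₁ X₂ (x ^ ε), 4 ^ (⌊1 / ε⌋₊ + 1) * M ^ 2 := Finset.sum_le_sum hterm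
    _ = (roughNonSqfree X₁ X₂ (x ^ ε)).card * (4 ^ (⌊1 / ε⌋₊ + 1) * M ^ 2) := by rw [Finset.sum_const, nsmul_eq_mul]
    _ ≤ ((X₂ : ℝ) / ⌊x ^ ε⌋₊) * (4 ^ (⌊1 / ε⌋₊ + 1) * M ^ 2) := by
        refine mul_le_mul_of_nonneg_right ?_ (by positivity)
        exact le_trans (by exact_mod_cast Finset.card_le_card (roughNonSqfree_subset_sqMultiples X₁ X₂ _)) (card_sqMultiples_le hz)
    _ = _ := by ring

end RoughTuples

end Literature.NumberTheory.Sieve
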